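import Summits.Ventures.HSemireg.WedgeHankelClassSpaceRaisingShearImages
import Summits.Ventures.HSemireg.WedgeHankelClassSpaceLoweringJordanType

/-!
# Venture HSemireg — SAME JORDAN TYPE, DIFFERENT FLAGS (lowering side): in characteristic `p`, for `c ≠ 0` and `1 ≤ j < p`, **`ker f^j = ker (SbC(1 0 c 1) − 1)^j ↔ n ≤ 2p − 2`**
# and **`range f^j = range (SbC(1 0 c 1) − 1)^j ↔ n ≤ p + j − 2`**, with the image flag **`range f^j = span{E_b : j ≤ (n − b) mod p}`** — N1/N6 transported by the Weyl element `S`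

HONEST FRAMING. Part of the Lean index of the computation cell `pub-hsemireg` (seat p10 gen 26, Sunday typer «UNIFORM-IN-n»).
Finite-dimensional linear algebra of endomorphisms of th-7's class space ONLY: no variety, no cohomology theory, no sheaf, no Ext group, no semiregularity map; nothing here says that
HC / HC_CM / HC_AV holds; no Literature fact is declared or used.  Custodian versions as in `WedgeHankelSiegelIdeal` (1/3) and `WedgeHankelFrameChange`; the dictionary (`e`, `f` = the
infinitesimal shears of th-7's class space, `S = SbC(0 1 1 0)` the Weyl element, `SbC(1 0 c 1)` the lower shear) is QUOTED, never asserted.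

WHAT IS IN THE TREE.  N1 (`WedgeHankelClassSpaceRaisingShearFlagsPow`): `ker_pow_raising_eq_ker_shear_sub_one_pow_iff` / `…_iff'` (`ker e^j = ker (SbC(1 λ 0 1) − 1)^j ↔ n ≤ 2p − 2`);
N6 (`WedgeHankelClassSpaceRaisingShearImages`): `range_pow_raising_eq_span_charP`, `range_pow_raising_eq_range_shear_sub_one_pow_iff` / `…_iff'` (`↔ n ≤ p + j − 2`); L7
(`WedgeHankelClassSpaceLoweringJordanType`): `pow_lowering_mul_swap` (`f^k S = S e^k`), `ker_pow_lowering_eq_map` (`ker f^k = S(ker e^k)`); the lower-shear flag leaf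
(`WedgeHankelSubstitutionLowerShearFlag`): `ker_pow_lower_shear_eq_map`, `range_pow_lower_shear_eq_map` (`= S(·)` of the upper shear's), `map_swap_span_spikeBasis`; `SbC_swap_mul_swap` (`S² = 1`).
K27's hypotheses `hE hEtop hF hF0`.  L7 named «the flags of `e`/`f` versus those of the shears as subspaces» as NOT typed; N1/N6 typed the `e` side; THIS FILE (namespace
`Summit.Ventures.HSemireg.Wedge.HankelFrameChange` continued; PLAIN on tree files; 0 definitions) types the `f` side:
* §489 `SbC_swap_injective`; **`range_pow_lowering_eq_map`** (`range f^j = S(range e^j)`); **`range_pow_lowering_eq_span_charP`** (`range f^j = span{E_b : j ≤ (n − b) mod p}`).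
* §490 `ker_pow_lowering_eq_ker_lower_shear_sub_one_pow_iff_raising` / `range_…_iff_raising` (the `f`-side equality of flags ↔ the `e`-side one, EVERY field, `j`, `c`), hence
  **`ker_pow_lowering_eq_ker_lower_shear_sub_one_pow_iff`** (`c ≠ 0`, `1 ≤ j < p`: `ker f^j = ker (SbC(1 0 c 1) − 1)^j ↔ n ≤ 2p − 2`), `…_iff'` (`↔ j = 0 ∨ p ≤ j ∨ n ≤ 2p − 2`),
  **`range_pow_lowering_eq_range_lower_shear_sub_one_pow_iff`** (`↔ n ≤ p + j − 2`), `…_iff'`.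
READING: all four nilpotents `e`, `f`, `SbC(1 λ 0 1) − 1`, `SbC(1 0 c 1) − 1` have the same Jordan type (L7); their kernel flags agree pairwise (`e` with the upper shear, `f` with the lower)
exactly for `n ≤ 2p − 2` and their image flags exactly for `n ≤ p + j − 2` — the `f` side is the `S`-reflection of the `e` side.  Nothing Ext-side.  New names only.
-/

open Module

namespace Summit.Ventures.HSemireg.Wedge.HankelFrameChange

open Summit.Ventures.HSemireg.Wedge Summit.Ventures.HSemireg.Wedge.Kunneth Summit.Ventures.HSemireg.Wedge.Hankel
  Summit.Ventures.HSemireg.Wedge.BasisFree Summit.Ventures.HSemireg.Wedge.HankelSiegel Summit.Ventures.HSemireg.Wedge.HankelSiegelIdeal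
  Summit.Ventures.HSemireg.Wedge.KunnethKernel Summit.Ventures.HSemireg.Wedge.HankelRankOne Summit.Ventures.HSemireg.Wedge.KernelDuality

variable (K : Type*) [Field K] {n : ℕ}

variable {e f : Module.End K (spikeSpan K n)}
  (hE : ∀ (i : Fin (n + 1)) (hi : (i : ℕ) < n), e (spikeBasis K n i) = (((i : ℕ) : K) + 1) • spikeBasis K n ⟨(i : ℕ) + 1, by omega⟩) (hEtop : e (spikeBasis K n (Fin.last n)) = 0)
  (hF : ∀ (i : Fin (n + 1)) (hi : 0 < (i : ℕ)), f (spikeBasis K n i) = ((n : K) - (i : ℕ) + 1) • spikeBasis K n ⟨(i : ℕ) - 1, by omega⟩) (hF0 : f (spikeBasis K n 0) = 0)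

/-! ## §489. The Weyl element transports the flags of `e` to the flags of `f` -/

/-- the swap is injective (`S² = 1`). -/
theorem SbC_swap_injective : Function.Injective (SbC K 0 1 1 0 (n := n)) := by
  intro x y hxy
  have := congrArg (SbC K 0 1 1 0 (n := n)) hxy
  rwa [← Module.End.mul_apply, ← Module.End.mul_apply, SbC_swap_mul_swap, Module.End.one_apply, Module.End.one_apply] at this

include hE hEtop hF hF0 in
/-- **`range f^j = S (range e^j)`** for every `j` (every field). -/
theorem range_pow_lowering_eq_map (j : ℕ) : LinearMap.range (f ^ j) = (LinearMap.range (e ^ j)).map (SbC K 0 1 1 0) := by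
  have h := pow_lowering_mul_swap K hE hEtop hF hF0 j
  have e1 : f ^ j = SbC K 0 1 1 0 * e ^ j * SbC K 0 1 1 0 := by rw [← h, mul_assoc, SbC_swap_mul_swap, mul_one]
  have hS : LinearMap.range (SbC K 0 1 1 0 (n := n)) = ⊤ :=
    LinearMap.range_eq_top.mpr fun g => ⟨SbC K 0 1 1 0 g, by rw [← Module.End.mul_apply, SbC_swap_mul_swap, Module.End.one_apply]⟩
  rw [e1, Module.End.mul_eq_comp, LinearMap.range_comp, hS, Submodule.map_top, Module.End.mul_eq_comp, LinearMap.range_comp]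

include hE hEtop hF hF0 in
/-- **THE IMAGE FLAG OF `f` IN CHARACTERISTIC `p`: `range f^j = span{E_b : j ≤ (n − b) mod p}`** (N6's flag of `e` reflected by the swap). -/
theorem range_pow_lowering_eq_span_charP (p : ℕ) [Fact p.Prime] [CharP K p] (j : ℕ) :
    LinearMap.range (f ^ j) = Submodule.span K (Set.range fun b : {b : Fin (n + 1) // j ≤ ((Fin.rev b : Fin (n + 1)) : ℕ) % p} => spikeBasis K n b) := by
  rw [range_pow_lowering_eq_map K hE hEtop hF hF0, range_pow_raising_eq_span_charP K hE hEtop p j, map_swap_span_spikeBasis]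

/-! ## §490. The kernel and image flags of `f` versus the lower shear `SbC(1 0 c 1)` — N1/N6 by the Weyl symmetry -/

include hE hEtop hF hF0 in
/-- **`ker f^j = ker (SbC(1 0 c 1) − 1)^j ↔ ker e^j = ker (SbC(1 c 0 1) − 1)^j`** (every field, every `j`, `c`): both sides are swapped images. -/
theorem ker_pow_lowering_eq_ker_lower_shear_sub_one_pow_iff_raising (c : K) (j : ℕ) :
    LinearMap.ker (f ^ j) = LinearMap.ker ((SbC K 1 0 c 1 - 1) ^ j) ↔ LinearMap.ker (e ^ j) = LinearMap.ker ((SbC K 1 c 0 1 - 1) ^ j) := by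
  rw [ker_pow_lowering_eq_map K hE hEtop hF hF0, ker_pow_lower_shear_eq_map K c j]
  exact (Submodule.map_injective_of_injective (SbC_swap_injective K)).eq_iff

include hE hEtop hF hF0 in
/-- images: **`range f^j = range (SbC(1 0 c 1) − 1)^j ↔ range e^j = range (SbC(1 c 0 1) − 1)^j`.** -/
theorem range_pow_lowering_eq_range_lower_shear_sub_one_pow_iff_raising (c : K) (j : ℕ) :
    LinearMap.range (f ^ j) = LinearMap.range ((SbC K 1 0 c 1 - 1) ^ j) ↔ LinearMap.range (e ^ j) = LinearMap.range ((SbC K 1 c 0 1 - 1) ^ j) := by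
  rw [range_pow_lowering_eq_map K hE hEtop hF hF0, range_pow_lower_shear_eq_map K c j]
  exact (Submodule.map_injective_of_injective (SbC_swap_injective K)).eq_iff

include hE hEtop hF hF0 in
/-- **SAME JORDAN TYPE, DIFFERENT KERNEL FLAGS (lowering side): in characteristic `p`, for `c ≠ 0` and `1 ≤ j < p`, `ker f^j = ker (SbC(1 0 c 1) − 1)^j ↔ n ≤ 2p − 2`** (N1 by the Weyl symmetry). -/
theorem ker_pow_lowering_eq_ker_lower_shear_sub_one_pow_iff (p : ℕ) [Fact p.Prime] [CharP K p] {c : K} (hc : c ≠ 0) {j : ℕ} (hj1 : 1 ≤ j) (hjp : j < p) :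
    LinearMap.ker (f ^ j) = LinearMap.ker ((SbC K 1 0 c 1 - 1) ^ j) ↔ n ≤ 2 * p - 2 := by
  rw [ker_pow_lowering_eq_ker_lower_shear_sub_one_pow_iff_raising K hE hEtop hF hF0, ker_pow_raising_eq_ker_shear_sub_one_pow_iff K hE hEtop p hc hj1 hjp]

include hE hEtop hF hF0 in
/-- all `j` at once: `ker f^j = ker (SbC(1 0 c 1) − 1)^j ↔ j = 0 ∨ p ≤ j ∨ n ≤ 2p − 2` (`c ≠ 0`). -/
theorem ker_pow_lowering_eq_ker_lower_shear_sub_one_pow_iff' (p : ℕ) [Fact p.Prime] [CharP K p] {c : K} (hc : c ≠ 0) (j : ℕ) :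
    LinearMap.ker (f ^ j) = LinearMap.ker ((SbC K 1 0 c 1 - 1) ^ j) ↔ j = 0 ∨ p ≤ j ∨ n ≤ 2 * p - 2 := by
  rw [ker_pow_lowering_eq_ker_lower_shear_sub_one_pow_iff_raising K hE hEtop hF hF0, ker_pow_raising_eq_ker_shear_sub_one_pow_iff' K hE hEtop p hc j]

include hE hEtop hF hF0 in
/-- **THE IMAGES SEPARATE FIRST (lowering side): in characteristic `p`, for `c ≠ 0` and `1 ≤ j < p`, `range f^j = range (SbC(1 0 c 1) − 1)^j ↔ n ≤ p + j − 2`** (N6 by the Weyl symmetry). -/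
theorem range_pow_lowering_eq_range_lower_shear_sub_one_pow_iff (p : ℕ) [Fact p.Prime] [CharP K p] {c : K} (hc : c ≠ 0) {j : ℕ} (hj1 : 1 ≤ j) (hjp : j < p) :
    LinearMap.range (f ^ j) = LinearMap.range ((SbC K 1 0 c 1 - 1) ^ j) ↔ n ≤ p + j - 2 := by
  rw [range_pow_lowering_eq_range_lower_shear_sub_one_pow_iff_raising K hE hEtop hF hF0, range_pow_raising_eq_range_shear_sub_one_pow_iff K hE hEtop p hc hj1 hjp]

include hE hEtop hF hF0 in
/-- all `j` at once: `range f^j = range (SbC(1 0 c 1) − 1)^j ↔ j = 0 ∨ p ≤ j ∨ n ≤ p + j − 2` (`c ≠ 0`). -/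
theorem range_pow_lowering_eq_range_lower_shear_sub_one_pow_iff' (p : ℕ) [Fact p.Prime] [CharP K p] {c : K} (hc : c ≠ 0) (j : ℕ) :
    LinearMap.range (f ^ j) = LinearMap.range ((SbC K 1 0 c 1 - 1) ^ j) ↔ j = 0 ∨ p ≤ j ∨ n ≤ p + j - 2 := by
  rw [range_pow_lowering_eq_range_lower_shear_sub_one_pow_iff_raising K hE hEtop hF hF0, range_pow_raising_eq_range_shear_sub_one_pow_iff' K hE hEtop p hc j]

end Summit.Ventures.HSemireg.Wedge.HankelFrameChange
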